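import Summits.BirchSwinnertonDyer.BirchSwinnertonDyer.Theorems.QuadraticBranchSignedControlPlusEtaNonsurjCMAnchorTransfer
import Summits.BirchSwinnertonDyer.BirchSwinnertonDyer.Theorems.QuadraticBranchSignedControlPlusEtaNonsurjCorpuzLeiTransferOPEN
import HarnessLib

/-!
# Route `QuadraticBranchSignedControl` (rung K8, cell `bsd-potss`), residual crux `PlusEtaMainConjectureNonsurj`
# (stmt-BirchSwinnertonDyer-19606): the CM-unit-anchor transfer road BY NAME — the displayed frame `hCL` of
# `EtaCMAnchorTransfer` (p552531) instantiated at the landed OPEN binder `CorpuzLei2025_etaPlusMainConjecture_transfer_OPEN`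
# (p552245) (a `--supports` file; seat `bsd-potss-k8eta-c2` g8)

WHAT. `Theorems/QuadraticBranchSignedControlPlusEtaNonsurjCMAnchorTransfer.lean` proves Kobayashi's even main conjecture at `η`
for every good `a_p = 0` curve congruent mod `p` to the twist of a CM unit anchor from a DISPLAYED transfer frame `hCL` (the body of
the OPEN binder, so as not to depend on its review). The binder `CorpuzLei2025_etaPlusMainConjecture_transfer_OPEN` (Corpuz–Lei
arXiv:2508.09733 Thms 1 + 2 + 3 at `i = (p−1)/2`, plus sign — an UNREFEREED PREPRINT, `@[conjecture] def`, never a theorem of record)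
has since LANDED (p552245, reviewed); THIS FILE re-issues the road, its ∀-models form and its ∀-form on the crux's binders with
`hCL` BY NAME (ns `EtaCMAnchorTransferByName`), so that a planner's stub `stub_etaMC_nonCM_anchored` can cite ONE named binder.

HONEST FRAMING (cell `bsd-potss`; HUMAN RULING D-0036/D-0074): TOOL THEOREMS ONLY — no definition, no new fact, no `sorry`, axioms
standard; CONDITIONAL on the OPEN binder (PRE; dictionary flag `CL25-eta-plus-dictionary`) and on modularity, GZK, Burungale–Flach
bsd.S28 in hypothesis position. 19606 stays OPEN; no stub is proved by name; nothing is booked; BSD(W,p) is claimed for no pair.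
`--supports stmt-BirchSwinnertonDyer-19606`.

References: [CorpuzLei2025] Thms 1–3 (claim; hypothesis only); [GreenbergVatsal2000] Thm. (1.4); [Kobayashi2003] §4 (p. 8);
[BurungaleFlach2024] Thm. 1.1, Cor. 2.
-/

set_option autoImplicit false
set_option linter.dupNamespace false

noncomputable section

open scoped Classical

open CongruenceSubgroup Field Function NumberField IsDedekindDomain WeierstrassCurve
open Literature.NumberTheory.EllipticCurves
open Literature.NumberTheory.EllipticCurves.ModularForms
open Literature.NumberTheory.EllipticCurves.Rank1Residual
open Literature.NumberTheory.EllipticCurves.Rank1Residual.Typed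
open Literature.NumberTheory.GaloisRepresentations
open Literature.NumberTheory.GaloisCohomology
open Literature.NumberTheory.EllipticCurves.IwasawaAlgebra
open Literature.NumberTheory.EllipticCurves.IwasawaDual ZpExtension
open Literature.NumberTheory.EllipticCurves.GreenbergVatsal2000
open Summit.BirchSwinnertonDyer.Rank1Residual.X11b.Levels
open Summit.BirchSwinnertonDyer.Rank1Residual.X11b
open Summit.BirchSwinnertonDyer.Rank1Residual.Additive
open Summit.BirchSwinnertonDyer.Rank1Residual.Additive.SignedTwist
open scoped ContRepresentation
open Summit.BirchSwinnertonDyer.Rank1Residual.AdditivePotMult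
open Summit.BirchSwinnertonDyer.Rank1Residual.O6 (ModPCongruent)

namespace Summit.BirchSwinnertonDyer.BirchSwinnertonDyer.Theorems

namespace EtaCMAnchorTransferByName

/-- **The CM-unit-anchor transfer road, BY NAME.** DATA: `p ≥ 5`; a CM curve `A/ℚ` (globally minimal) with `L(A,1) ≠ 0`,
`v_p(#Ш(A)_an) ≤ 0`, `p ∤ Tam(A)`; a globally minimal model `V′` of `A^{(p*)}` good at `p` with `a_p(V′) = 0`; a globally minimal
`V`, good at `p` with `a_p(V) = 0`, `ModPCongruent V′ V p`. Granted the OPEN binder `hCL` (Corpuz–Lei 2025, PRE), modularity, GZK and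
bsd.S28: `QuadraticBranchPlusEtaMainConjectureAt V p` — any rank, any `L_p⁺`-shape, no image hypothesis. (= `EtaCMAnchorTransfer.
quadraticBranchPlusEtaMainConjectureAt_of_cmUnitAnchor_of_transferFrame` at the named binder.) CONDITIONAL; nothing booked.
[claim: CorpuzLei2025, status: under-review] [cite: GreenbergVatsal2000, Thm. (1.4)] [cite: Kobayashi2003, §4 Even main conjecture (p. 8)]
[cite: BurungaleFlach2024, Thm. 1.1 and Cor. 2] -/
theorem quadraticBranchPlusEtaMainConjectureAt_of_cmUnitAnchor
    (hCL : CorpuzLei2025_etaPlusMainConjecture_transfer_OPEN)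
    (hmod : hasEntireLFunction_rat) (hGZK : rank_eq_analyticRank_of_analyticRank_le_one)
    (hS28 : bsdTriple_of_hasCM_of_L_one_ne_zero) (p : ℕ) [Fact p.Prime] (hp5 : 5 ≤ p)
    (A : WeierstrassCurve ℚ) [A.IsElliptic] [A.IsGloballyMinimal] (hCM : A.HasCM)
    (hLA : A.entireLFunction 1 ≠ 0) (hsha : ∃ s : ℚ, shaAn A = (s : ℂ) ∧ padicValRat p s ≤ 0)
    (htam : ¬ p ∣ A.tamagawaProduct)
    (V' : WeierstrassCurve ℚ) [V'.IsElliptic] [V'.IsGloballyMinimal] (C' : VariableChange ℚ)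
    (hC'V' : C' • A.quadraticTwist ((-1) ^ (p / 2) * p) = V') (hgood' : V'.HasGoodReductionAtPrime p)
    (hap' : V'.frobeniusTrace p = 0)
    (V : WeierstrassCurve ℚ) [V.IsElliptic] [V.IsGloballyMinimal] (hgood : V.HasGoodReductionAtPrime p)
    (hap : V.frobeniusTrace p = 0) (hcong : ModPCongruent V' V p) :
    QuadraticBranchPlusEtaMainConjectureAt V p :=
  EtaCMAnchorTransfer.quadraticBranchPlusEtaMainConjectureAt_of_cmUnitAnchor_of_transferFrame p hCL hmod hGZK hS28 hp5 A
    hCM hLA hsha htam V' C' hC'V' hgood' hap' V hgood hap hcong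

/-- **19606 on its ANCHORED rows, BY NAME** — the ∀-form on the crux's binders GIVEN a CM unit anchor datum (a CM curve `A` with
`L(A,1) ≠ 0`, `v_p(#Ш(A)_an) ≤ 0`, `p ∤ Tam(A)`, a good `a_p = 0` globally minimal model `V′` of `A^{(p*)}`, and `ModPCongruent V′ V p`),
granted the OPEN binder `CorpuzLei2025_etaPlusMainConjecture_transfer_OPEN` (PRE), modularity, GZK and bsd.S28 — the TEXT proposed to
the planner for a v7 stub `stub_etaMC_nonCM_anchored` (its complement, the non-CM rows with no CM unit anchor in their mod-`p` class,
is EMPTY in-table — census `pub/bsd-potss/k8eta-c2/g8/K8-CM-UNIT-ANCHORS-k8eta-c2-g8.tsv`, 30/30 — and OPEN class-wide). CONDITIONAL;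
no stub proved by name; nothing booked. [claim: CorpuzLei2025, status: under-review] [cite: Kobayashi2003, §4 Even main conjecture (p. 8)]
[cite: GreenbergVatsal2000, Thm. (1.4)] [cite: BurungaleFlach2024, Thm. 1.1 and Cor. 2] -/
theorem etaMC_anchoredRows (hCL : CorpuzLei2025_etaPlusMainConjecture_transfer_OPEN)
    (hmod : hasEntireLFunction_rat) (hGZK : rank_eq_analyticRank_of_analyticRank_le_one)
    (hS28 : bsdTriple_of_hasCM_of_L_one_ne_zero) :
    ∀ (V : WeierstrassCurve ℚ) [V.IsElliptic] [V.IsGloballyMinimal] (p : ℕ) [Fact p.Prime],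
      5 ≤ p → V.HasGoodReductionAtPrime p → V.frobeniusTrace p = 0 →
      ¬ (∀ m : ℕ, V.HasSurjectiveModNGaloisRep (p ^ m : ℕ)) →
      ∀ (A : WeierstrassCurve ℚ) [A.IsElliptic] [A.IsGloballyMinimal]
        (V' : WeierstrassCurve ℚ) [V'.IsElliptic] [V'.IsGloballyMinimal] (C' : VariableChange ℚ),
        A.HasCM → A.entireLFunction 1 ≠ 0 → (∃ s : ℚ, shaAn A = (s : ℂ) ∧ padicValRat p s ≤ 0) →
        ¬ p ∣ A.tamagawaProduct → C' • A.quadraticTwist ((-1) ^ (p / 2) * p) = V' →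
        V'.HasGoodReductionAtPrime p → V'.frobeniusTrace p = 0 → ModPCongruent V' V p →
        QuadraticBranchPlusEtaMainConjectureAt V p :=
  EtaCMAnchorTransfer.etaMC_anchoredRows_of_transferFrame hCL hmod hGZK hS28

/-- **The Eisenstein half on the anchored rows, BY NAME**: (E⁺_η) `QuadraticBranchPlusEtaLowerInclusionAt V p` — the conclusion of
the crux's hardest stub `stub_etaMC_nonCM_lower` — at every row congruent to the twist of a CM unit anchor, from the transferred
(C1⁺_η) (`quadraticBranchPlusEtaLowerInclusionAt_of_plusEtaMainConjectureAt`). Granted the OPEN binder (PRE), modularity, GZK,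
bsd.S28. CONDITIONAL; nothing booked. [claim: CorpuzLei2025, status: under-review] [cite: Kobayashi2003, §4 Even main conjecture and Thm. 4.1 (p. 8)] -/
theorem plusEtaLowerInclusionAt_of_cmUnitAnchor
    (hCL : CorpuzLei2025_etaPlusMainConjecture_transfer_OPEN)
    (hmod : hasEntireLFunction_rat) (hGZK : rank_eq_analyticRank_of_analyticRank_le_one)
    (hS28 : bsdTriple_of_hasCM_of_L_one_ne_zero) (p : ℕ) [Fact p.Prime] (hp5 : 5 ≤ p)
    (A : WeierstrassCurve ℚ) [A.IsElliptic] [A.IsGloballyMinimal] (hCM : A.HasCM)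
    (hLA : A.entireLFunction 1 ≠ 0) (hsha : ∃ s : ℚ, shaAn A = (s : ℂ) ∧ padicValRat p s ≤ 0)
    (htam : ¬ p ∣ A.tamagawaProduct)
    (V' : WeierstrassCurve ℚ) [V'.IsElliptic] [V'.IsGloballyMinimal] (C' : VariableChange ℚ)
    (hC'V' : C' • A.quadraticTwist ((-1) ^ (p / 2) * p) = V') (hgood' : V'.HasGoodReductionAtPrime p)
    (hap' : V'.frobeniusTrace p = 0)
    (V : WeierstrassCurve ℚ) [V.IsElliptic] [V.IsGloballyMinimal] (hgood : V.HasGoodReductionAtPrime p)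
    (hap : V.frobeniusTrace p = 0) (hcong : ModPCongruent V' V p) :
    QuadraticBranchPlusEtaLowerInclusionAt V p :=
  quadraticBranchPlusEtaLowerInclusionAt_of_plusEtaMainConjectureAt
    (quadraticBranchPlusEtaMainConjectureAt_of_cmUnitAnchor hCL hmod hGZK hS28 p hp5 A hCM hLA hsha htam V' C' hC'V' hgood'
      hap' V hgood hap hcong)

end EtaCMAnchorTransferByName

end Summit.BirchSwinnertonDyer.BirchSwinnertonDyer.Theorems

end
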